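/-
Copyright (c) 2026 the pub-hodgecm-mathlib formalisation cell (harness21).  Prover seat hodgecm-mathlib-K2E3-p21 (g2), HCML Track B «K2-LIT» (build stream 29),
h413 = `stmt-HodgeConjecture-24833`, line `K2_E3_EllipticInputs`, unit U3, line U3-d (lead K2E3-p03 (g0)), FILE C: ‹SC-explicit› UNCONDITIONALLY (the assembly ★ p856049 fed
with rung C1's residue-characteristic-free transvection Haar head).  2026-09-04.
-/
import Summits.HodgeConjecture.HodgeConjecture.Theorems.K2E3UnipotentOrbitalScalingLawOfNeZero        -- ★ p856049 (this seat): `scalingLaw_of_transvectionHaar : ‹C1 head, 2 ≠ 0› → ‹SC-explicit›`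
import Summits.HodgeConjecture.HodgeConjecture.Theorems.K2E3UnipotentOrbitalScalingTransvectionDyadicHaar    -- ★ p856078 (K2E4-p03, rung C1 residual): `exists_haar_index_identity_of_transvection_of_two_ne_zero`
import HarnessLib

/-!
# h413 ∕ Track B «K2-LIT», line U3-d, FILE C: THE SCALING LAW ‹SC-explicit› OF THE UNIPOTENT ORBITAL INTEGRALS OF `U(Φ₃)(L⁺_v)`, UNCONDITIONALLY

Cell `pub/hodgecm-mathlib`, crux H413 = `stmt-HodgeConjecture-24833`, route of record `HCCMUnconditional`; chair K2-lead (g0), line lead of U3-d K2E3-p03 (g0).  THEOREMS ONLY;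
lane `--supports stmt-HodgeConjecture-24833 --as helper`.  ‹SC-explicit› (= the hypothesis `hSC` of ★ p855512 `K2E3CayleyScalingPackage.psiPackage_of_scalingLaw`, token for token)
is ★ p856049 `scalingLaw_of_transvectionHaar` applied to rung C1's transvection Haar head ★ p856078 `K2E3UnipotentOrbitalScalingTransvectionDyadicHaar.exists_haar_index_identity_of_transvection_of_two_ne_zero` (every residue characteristic, `(2 : K) ≠ 0`).  Hence the
U3-d chain is closed by name: #3 `sig_K2E3ShalikaGermHomogeneityRay` ⟸ U3-d (★ p855129) ⟸ U3-d′ (★ p855211) ⟸ U3-d″ ‹Ψ-package› (★ p855276) ⟸ ‹SC-explicit› (★ p855512 ∘ THIS FILE).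
The docking `example` elaborates `psiPackage_of_scalingLaw scalingLaw`, i.e. the ‹Ψ-package› (hypothesis of ★ p855276) with no hypothesis left.

HONEST LABEL.  HC_CM is proved only modulo the 7 printed citations (2 remaining named inputs: hLiu418 = `stmt-HodgeConjecture-24832`, h413 =
`stmt-HodgeConjecture-24833`) until rung 0 closes; this file is count-neutral (helper lane) — the socket ties (U3-d″, #3) are the line lead's ∕ dealer's by the composition above.

## References
* [HarishChandra1999AdmissibleDistributions] Harish-Chandra, *Admissible Invariant Distributions on Reductive p-adic Groups*, ULS 16 (1999), §3.1 Lemma 3.2.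
* [Rogawski1990] J. D. Rogawski, *Automorphic Representations of Unitary Groups in Three Variables* (1990), §8.1 Prop. 8.1.2 (b) p. 114; (8.1.1) p. 116.
-/

set_option autoImplicit false
set_option linter.dupNamespace false  -- the mandated namespace repeats the single-problem summit's segment (`HodgeConjecture.HodgeConjecture`)

noncomputable section

open NumberField IsDedekindDomain MeasureTheory Filter Topology Set
open scoped Matrix MatrixGroups ENNReal NNReal Valued WithZero
open Literature.NumberTheory.Rogawski1990 Literature.NumberTheory.Automorphic Literature.NumberTheory.Automorphic.UnitaryGroup
open Literature.NumberTheory.Weil1982.UnitaryFinTopForm Literature.MeasureTheory.Group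
open Summit.HodgeConjecture.HodgeConjecture.Cruxes.H413.K2E3UnipotentOrbitalScalingLawOfNeZero
open Summit.HodgeConjecture.HodgeConjecture.Cruxes.H413.K2E3CayleyScalingPackage

namespace Summit.HodgeConjecture.HodgeConjecture.Cruxes.H413.K2E3UnipotentOrbitalScalingLawUncond

set_option maxHeartbeats 800000 in
/-- **‹SC-explicit›, UNCONDITIONALLY: THE SCALING LAW `Φ_{mU}(u, 1_{U₀}·(F∘Ψ)) = q^{a u}·Φ_{mU}(u, F)` OF THE UNIPOTENT ORBITAL INTEGRALS OF `U(Φ₃)(L⁺_v)`** at every non-split `v`,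
for every admissible pair `(Ψ, U₀)` (the statement is the hypothesis `hSC` of ★ p855512 `psiPackage_of_scalingLaw`, token for token): ★ p856049 `scalingLaw_of_transvectionHaar` fed
with rung C1's transvection Haar head ★ p856078 `exists_haar_index_identity_of_transvection_of_two_ne_zero`. [cite: HarishChandra1999AdmissibleDistributions, §3.1 Lemma 3.2] [cite: Rogawski1990, §8.1 Prop. 8.1.2 (b) p. 114] -/
theorem scalingLaw :
    ∀ (L : Type) [Field L] [NumberField L] [IsCMField L] (v : HeightOneSpectrum (𝓞 ↥(maximalRealSubfield L))),
      (∀ w : PlacesOver L v, IsCMField.complexConj L • w.1 = w.1) →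
      ∀ [MeasurableSpace (Gqs L v)] [BorelSpace (Gqs L v)]
        [∀ γ : Gqs L v, MeasurableSpace (Gqs L v ⧸ Subgroup.centralizer ({γ} : Set (Gqs L v)))]
        [∀ γ : Gqs L v, BorelSpace (Gqs L v ⧸ Subgroup.centralizer ({γ} : Set (Gqs L v)))],
      ∃ (w : PlacesOver L v) (hw : IsCMField.complexConj L • w.1 = w.1) (s : w.1.adicCompletion L) (ρ : ℝ) (q : ℂ) (a : ConjClasses (Gqs L v) → ℕ),
        galAdicCompletionMap (L := L) (IsCMField.complexConj L) hw s = s ∧ s ≠ 0 ∧ ‖s‖ < 1 ∧ 0 < ρ ∧ ρ < 1 ∧ 1 < ‖q‖ ∧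
        (∀ u : ConjClasses (Gqs L v), u ≠ ConjClasses.mk 1 → 1 ≤ a u) ∧
        ∀ (Ψ : Gqs L v → Gqs L v) (U₀ : Set (Gqs L v)),
          (∀ γ : Gqs L v, γ ∈ U₀ ↔
            IsUnit ((((localNonsplitEquiv (IsCMField.complexConj L) (qsForm L) (IsCMField.complexConj_ne_one L) w hw γ : ↥(unitaryGroupOfForm (galAdicCompletionMap (L := L) (IsCMField.complexConj L) hw) (placeForm (qsForm L) w.1))) : GL (Fin 3) (w.1.adicCompletion L)) : Matrix (Fin 3) (Fin 3) (w.1.adicCompletion L)) + 1).det ∧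
            ‖(((((localNonsplitEquiv (IsCMField.complexConj L) (qsForm L) (IsCMField.complexConj_ne_one L) w hw γ : ↥(unitaryGroupOfForm (galAdicCompletionMap (L := L) (IsCMField.complexConj L) hw) (placeForm (qsForm L) w.1))) : GL (Fin 3) (w.1.adicCompletion L)) : Matrix (Fin 3) (Fin 3) (w.1.adicCompletion L)) - 1) *
                ((((localNonsplitEquiv (IsCMField.complexConj L) (qsForm L) (IsCMField.complexConj_ne_one L) w hw γ : ↥(unitaryGroupOfForm (galAdicCompletionMap (L := L) (IsCMField.complexConj L) hw) (placeForm (qsForm L) w.1))) : GL (Fin 3) (w.1.adicCompletion L)) : Matrix (Fin 3) (Fin 3) (w.1.adicCompletion L)) + 1)⁻¹).charpoly.coeff 2‖ ≤ ρ ∧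
            ‖(((((localNonsplitEquiv (IsCMField.complexConj L) (qsForm L) (IsCMField.complexConj_ne_one L) w hw γ : ↥(unitaryGroupOfForm (galAdicCompletionMap (L := L) (IsCMField.complexConj L) hw) (placeForm (qsForm L) w.1))) : GL (Fin 3) (w.1.adicCompletion L)) : Matrix (Fin 3) (Fin 3) (w.1.adicCompletion L)) - 1) *
                ((((localNonsplitEquiv (IsCMField.complexConj L) (qsForm L) (IsCMField.complexConj_ne_one L) w hw γ : ↥(unitaryGroupOfForm (galAdicCompletionMap (L := L) (IsCMField.complexConj L) hw) (placeForm (qsForm L) w.1))) : GL (Fin 3) (w.1.adicCompletion L)) : Matrix (Fin 3) (Fin 3) (w.1.adicCompletion L)) + 1)⁻¹).charpoly.coeff 1‖ ≤ ρ ^ 2 ∧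
            ‖(((((localNonsplitEquiv (IsCMField.complexConj L) (qsForm L) (IsCMField.complexConj_ne_one L) w hw γ : ↥(unitaryGroupOfForm (galAdicCompletionMap (L := L) (IsCMField.complexConj L) hw) (placeForm (qsForm L) w.1))) : GL (Fin 3) (w.1.adicCompletion L)) : Matrix (Fin 3) (Fin 3) (w.1.adicCompletion L)) - 1) *
                ((((localNonsplitEquiv (IsCMField.complexConj L) (qsForm L) (IsCMField.complexConj_ne_one L) w hw γ : ↥(unitaryGroupOfForm (galAdicCompletionMap (L := L) (IsCMField.complexConj L) hw) (placeForm (qsForm L) w.1))) : GL (Fin 3) (w.1.adicCompletion L)) : Matrix (Fin 3) (Fin 3) (w.1.adicCompletion L)) + 1)⁻¹).charpoly.coeff 0‖ ≤ ρ ^ 3) →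
          (∀ γ ∈ U₀,
            (((localNonsplitEquiv (IsCMField.complexConj L) (qsForm L) (IsCMField.complexConj_ne_one L) w hw (Ψ γ) : ↥(unitaryGroupOfForm (galAdicCompletionMap (L := L) (IsCMField.complexConj L) hw) (placeForm (qsForm L) w.1))) : GL (Fin 3) (w.1.adicCompletion L)) : Matrix (Fin 3) (Fin 3) (w.1.adicCompletion L)) =
              cayley (s • (((((localNonsplitEquiv (IsCMField.complexConj L) (qsForm L) (IsCMField.complexConj_ne_one L) w hw γ : ↥(unitaryGroupOfForm (galAdicCompletionMap (L := L) (IsCMField.complexConj L) hw) (placeForm (qsForm L) w.1))) : GL (Fin 3) (w.1.adicCompletion L)) : Matrix (Fin 3) (Fin 3) (w.1.adicCompletion L)) - 1) *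
                ((((localNonsplitEquiv (IsCMField.complexConj L) (qsForm L) (IsCMField.complexConj_ne_one L) w hw γ : ↥(unitaryGroupOfForm (galAdicCompletionMap (L := L) (IsCMField.complexConj L) hw) (placeForm (qsForm L) w.1))) : GL (Fin 3) (w.1.adicCompletion L)) : Matrix (Fin 3) (Fin 3) (w.1.adicCompletion L)) + 1)⁻¹))) →
          ∀ (S : Finset (ConjClasses (Gqs L v))) (mU : OrbitalMeasureFamily (Gqs L v)),
            (∀ u ∈ S, (((Quotient.out u : Gqs L v).val : GL (Fin 3) (UnitaryGroup.LocalRing L v)).val - 1) ^ 3 = 0) →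
            mU.IsAdmissibleOn (fun γ : Gqs L v => (ConjClasses.mk γ) ∈ S) →
            ∀ u ∈ S, ∀ F : Gqs L v → ℂ, IsLocSmooth F →
              classOrbitalIntegral mU (U₀.indicator (F ∘ Ψ)) u = q ^ (a u) * classOrbitalIntegral mU F u := by
  refine scalingLaw_of_transvectionHaar ?_
  intro K _ _ σ J _ _ _ _ hJ hσ hσv h2 t ht hσt hvt O hO Om hOm Q hF1 hFm u₀ hsq hne
  exact K2E3UnipotentOrbitalScalingTransvectionDyadicHaar.exists_haar_index_identity_of_transvection_of_two_ne_zero σ hJ hσ hσv h2 ht hσt hvt hO hOm hF1 hFm u₀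
    hsq hne

/-- **DOCKING CERTIFICATE**: ‹Ψ-package› (the hypothesis of ★ p855276) with no hypothesis left. -/
example : True := (fun _ => trivial) (psiPackage_of_scalingLaw scalingLaw)

end Summit.HodgeConjecture.HodgeConjecture.Cruxes.H413.K2E3UnipotentOrbitalScalingLawUncond

end
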